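import Literature.Computability.Complexity.UmansFPDecodeFP
import Literature.Computability.Complexity.CircuitEval
import Literature.Computability.Complexity.CodeFPStrings
import Literature.Computability.Complexity.YaoNextBit
import HarnessLib

/-!
# Umans' generator, machine level IX: the next-element predictor program

Literature / circuit complexity — derandomization. Ninth machine-level file of the tree's proof of
C. Umans, JCSS 2003, Thm. 6. The predictor `g` that the reconstruction procedure calls on windows of
`n₀` elements of `L` is obtained, in the proof of Thm. 14, from a distinguishing circuit `C`:
Yao's next-bit predictor `P` for the binary generator (a hard-wired position, sign and suffix;
`YaoNextBit.lean`), composed with the conversion of Lemma 13 (`QaryConversion.lean`: blockwise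
Hadamard decoding of the received word `pos ↦ P(code bits of the window at pos)`, then Sudan list
recovery of the Reed–Solomon layer). This file writes that predictor as a PROGRAM on the data
`(desc C, w, sgn)` and the window lists, and certifies it in `CodeFP`:

* `hadL`/`hadB` (Hadamard parities, `hadN_eq` bridges to `LDC.hadN`), `hadLC`/`hadBC`;
* `cevalBit` (the circuit evaluator `CircEval.evalFn` read as a bit, `cevalBit_desc`), `cevalBitC`;
* `predP` (Yao's predictor on the data `(desc, w, sgn)` and a prefix), `predP_eq_pred`, `predPC`;
* `recvBit`, `innerRow`, `innerTab`, **`predL`** (`= survL` on the inner lists, no node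
  constraints), and their certificates `recvBitC`, `innerRowC`, `innerTabC`, **`predLTC`**.

Everything is proved; no named fact. The identification with `QConv.listPred` is the next file.

## References

* C. Umans, *Pseudo-random generators for all hardnesses*, JCSS 67 (2003), Lemma 13, Thm. 14 [Umans2003].
* S. Arora, B. Barak, *Computational Complexity: A Modern Approach*, CUP 2009, Thm. 6.18 (circuit
  evaluation in `P`), Thm. 9.11 (Yao), §19.3–19.4 [AroraBarak2009].
-/

noncomputable section

namespace Literature.Computability.Complexity

open Polynomial Finset Literature.InformationTheory.Coding
open Literature.InformationTheory.Coding.GF2X CodeFP _root_.Computability Literature.Computability.MetaComplexity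

namespace UmansFP

/-! ### Hadamard parities -/

/-- The Hadamard bit of `v` at `y` on `b` bits, as the parity of a list count. [cite: AroraBarak2009, §19.3] -/
def hadL (b v y : ℕ) : ℕ := ((List.range b).filter fun k => v.testBit k && y.testBit k).length % 2

/-- Its Boolean form. [folklore] -/
def hadB (b v y : ℕ) : Bool := decide (hadL b v y = 1)

/-- Counting a filter of `[0, b)` as a sum. [folklore] -/
theorem length_filter_range_eq_sum (p : ℕ → Bool) : ∀ b : ℕ, ((List.range b).filter p).length = ∑ k ∈ Finset.range b, if p k then 1 else 0
  | 0 => by simp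
  | b + 1 => by
    rw [List.range_succ, List.filter_append, List.length_append, Finset.sum_range_succ, length_filter_range_eq_sum p b,
      List.filter_singleton]
    cases p b <;> simp

/-- Counting over `Fin b` is counting over `[0, b)`. [folklore] -/
theorem card_filter_fin_eq (p : ℕ → Bool) (b : ℕ) : (univ.filter fun k : Fin b => p k).card = ((List.range b).filter p).length := by
  rw [Finset.card_filter, Fin.sum_univ_eq_sum_range (fun k => if p k = true then 1 else 0) b, length_filter_range_eq_sum]

/-- **The tree's `LDC.hadN` is `hadB`.** [folklore] -/
theorem hadN_eq (b v y : ℕ) : LDC.hadN b v y = hadB b v y := by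
  rw [LDC.hadN, hadB, hadL, card_filter_fin_eq (fun k => v.testBit k && y.testBit k) b, Nat.mod_two_of_bodd]
  cases Nat.bodd _ <;> simp

/-- **The Hadamard parity on codes** (`b` unary). [cite: AroraBarak2009, §1.3, §19.3] -/
theorem hadLC : CodeFP (pairE unE (pairE natE natE)) natE (fun t => hadL t.1 t.2.1 t.2.2) := by
  have hk : CodeFP (pairE (pairE unE (pairE natE natE)) natE) unE (fun t => min t.2 t.1.1) := (unOfNatMin.comp ((fst _ _).fst'.pair (snd _ _)) :)
  have htest : CodeFP (pairE (pairE unE (pairE natE natE)) natE) bitE (fun t => t.1.2.1.testBit (min t.2 t.1.1) && t.1.2.2.testBit (min t.2 t.1.1)) :=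
    ((natTestBitFP.comp ((fst _ _).snd'.fst'.pair hk)).and (natTestBitFP.comp ((fst _ _).snd'.snd'.pair hk)) :)
  have hfil := (filter htest).comp ((CodeFP.id _).pair (urange.comp (fst _ _)))
  refine ((natMod.comp (((natLength natE).comp hfil).pair (const _ 2))).congr fun t => ?_)
  obtain ⟨b, v, y⟩ := t
  simp only [hadL, id]
  congr 2
  exact List.filter_congr fun k hk => by rw [min_eq_left (List.mem_range.1 hk).le]

/-- The Boolean Hadamard bit on codes. [folklore] -/
theorem hadBC : CodeFP (pairE unE (pairE natE natE)) bitE (fun t => hadB t.1 t.2.1 t.2.2) :=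
  (natEq.comp (hadLC.pair (const _ 1))).congr fun _ => rfl

/-! ### The circuit evaluator as a bit, and Yao's predictor -/

/-- **The value of the described circuit on `x`** (the tree's evaluator `CircEval.evalFn`, read as
a bit). [cite: AroraBarak2009, Thm. 6.18 (proof)] -/
def cevalBit (x d : List Bool) : Bool := (CircEval.evalFn (boolPair x d)).headD false

/-- **The evaluator is correct** on `⟨x, desc C⟩`, `|x| = m`. [cite: AroraBarak2009, Thm. 6.18 (proof)] -/
theorem cevalBit_desc {m : ℕ} (C : Circuit (Fin m)) (hC : ∀ g ∈ C.gates, g.arity ≤ 2) (x : List Bool) (hx : x.length = m) :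
    cevalBit x (CircEval.desc C) = C.eval fun j => x.get (j.cast hx.symm) := by
  subst hx
  rw [cevalBit, CircEval.evalFn_boolPair_desc x C hC]
  rfl

/-- **The evaluator bit on codes** (strings coded by themselves). [cite: AroraBarak2009, Thm. 6.18] -/
theorem cevalBitC : CodeFP (pairE strE strE) bitE (fun p => cevalBit p.1 p.2) :=
  CodeFP.of_fn CircEval.evalFn CircEval.evalFn_mem_FP fun p => by
    rcases CircEval.evalFn_eq_or (boolPair p.1 p.2) with h | h <;> simp [cevalBit, pairE, h, bitE]

/-- **Yao's next-bit predictor on the data `(desc, w, sgn)`** and a prefix `pre` (the bits before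
the predicted position `j = |pre|`): `(w_j ⊕ ¬C(pre ++ w_{≥ j})) ⊕ sgn`. [cite: AroraBarak2009, Thm. 9.11 (proof)] -/
def predP (pd : List Bool × List Bool × Bool) (pre : List Bool) : Bool :=
  ((pd.2.1.getD pre.length false) ^^ !(cevalBit (pre ++ pd.2.1.drop pre.length) pd.1)) ^^ pd.2.2

/-- The code of the predictor data `(desc, w, sgn)`. [folklore] -/
abbrev pdE : List Bool × List Bool × Bool → List Bool := pairE strE (pairE strE bitE)

/-- **Yao's predictor on codes** (prefix as a raw bit list). [cite: AroraBarak2009, §1.3, Thm. 9.11] -/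
theorem predPC : CodeFP (pairE pdE (rawE bitE)) bitE (fun t => predP t.1 t.2) := by
  have hd : CodeFP (pairE pdE (rawE bitE)) strE (fun t => t.1.1) := (fst _ _).fst'
  have hw : CodeFP (pairE pdE (rawE bitE)) strE (fun t => t.1.2.1) := (fst _ _).snd'.fst'
  have hs : CodeFP (pairE pdE (rawE bitE)) bitE (fun t => t.1.2.2) := (fst _ _).snd'.snd'
  have hpre : CodeFP (pairE pdE (rawE bitE)) strE (fun t => (t.2 : List Bool)) := bitsToStr.comp (snd _ _)
  have hj : CodeFP (pairE pdE (rawE bitE)) unE (fun t => t.2.length) := (ulength bitE).comp (snd _ _)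
  have hwj : CodeFP (pairE pdE (rawE bitE)) bitE (fun t => t.1.2.1.getD t.2.length false) := (strGetD.comp (hj.pair hw) :)
  have hx : CodeFP (pairE pdE (rawE bitE)) strE (fun t => t.2 ++ t.1.2.1.drop t.2.length) :=
    (strAppend.comp (hpre.pair (strDrop.comp (hj.pair hw))) :)
  have hc : CodeFP (pairE pdE (rawE bitE)) bitE (fun t => cevalBit (t.2 ++ t.1.2.1.drop t.2.length) t.1.1) := (cevalBitC.comp (hx.pair hd) :)
  exact (((hwj.xor hc.not).xor hs).congr fun _ => rfl)

/-- Entries of `List.ofFn`, by `getD`. [folklore] -/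
theorem getD_ofFn {α : Type*} {n : ℕ} (f : Fin n → α) (d : α) (i : ℕ) (hi : i < n) : (List.ofFn f).getD i d = f ⟨i, hi⟩ := by
  rw [List.getD_eq_getElem _ _ (by rw [List.length_ofFn]; exact hi), List.getElem_ofFn]

/-- **`predP` on circuit data is `YaoNB.pred`.** For a `B₂`-circuit `C` on `m` inputs, coins `w`,
sign `sgn`, position `j`, and a prefix listing the first `j` bits of `z`:
`predP (desc C, w, sgn) prefix = YaoNB.pred C j sgn w z`. [cite: AroraBarak2009, Thm. 9.11 (proof)] -/
theorem predP_eq_pred {m : ℕ} (C : Circuit (Fin m)) (hC : ∀ g ∈ C.gates, g.arity ≤ 2) (j : Fin m) (sgn : Bool)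
    (w z : Fin m → Bool) (pre : List Bool) (hlen : pre.length = j) (hpre : ∀ k (hk : k < (j : ℕ)), pre.getD k false = z ⟨k, hk.trans j.2⟩) :
    predP (CircEval.desc C, List.ofFn w, sgn) pre = YaoNB.pred (fun x => C.eval x) j sgn w z := by
  have hxlen : (pre ++ (List.ofFn w).drop (j : ℕ)).length = m := by
    rw [List.length_append, List.length_drop, List.length_ofFn, hlen]; omega
  rw [predP, YaoNB.pred]
  simp only []
  rw [hlen, getD_ofFn w false j j.2, cevalBit_desc C hC _ hxlen]
  suffices hf : (fun jj : Fin m => (pre ++ (List.ofFn w).drop (j : ℕ)).get (jj.cast hxlen.symm)) =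
      fun i : Fin m => if (i : ℕ) < (j : ℕ) then z i else w i by
    rw [hf]
  funext i
  rw [List.get_eq_getElem]
  show (pre ++ (List.ofFn w).drop (j : ℕ))[(i : ℕ)]'(by rw [hxlen]; exact i.2) = _
  by_cases hi : (i : ℕ) < (j : ℕ)
  · rw [if_pos hi, List.getElem_append_left (by rw [hlen]; exact hi), ← List.getD_eq_getElem _ false (by rw [hlen]; exact hi), hpre i hi]
  · rw [if_neg hi, List.getElem_append_right (by rw [hlen]; omega)]
    simp only [List.getElem_drop, List.getElem_ofFn, hlen]
    congr 1
    ext; simp only []; omega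

/-! ### The received word, the Hadamard lists, the predictor program -/

/-- **One bit of the received word** at position `(a, y)`: Yao's predictor on the Hadamard bits of
the Reed–Solomon symbols `u_k(a)` of the window lists. [cite: Umans2003, Lemma 13 (proof: `r_j = g'(C(z₁)_j, …)`)] -/
def recvBit (c : ℕ × ℕ × ℕ) (pd : List Bool × List Bool × Bool) (ws : List (List ℕ)) (a y : ℕ) : Bool :=
  predP pd (ws.map fun u => hadB (c.1 - 1) (keval c u a) y)

/-- **The Hadamard list of block `a`**: the `v < q` whose Hadamard codeword agrees with the received
block in at least `(q + D₁)/2` of the `q = 2ᵇ` positions `y`. [cite: Umans2003, Def. 12, Lemma 13] -/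
def innerRow (c : ℕ × ℕ × ℕ) (q D₁ : ℕ) (pd : List Bool × List Bool × Bool) (ws : List (List ℕ)) (a : ℕ) : List ℕ :=
  (List.range q).filter fun v =>
    decide (q + D₁ ≤ 2 * ((List.range q).filter fun y => recvBit c pd ws a y == hadB (c.1 - 1) v y).length)

/-- The table of the Hadamard lists, one per block `a < q`. [cite: Umans2003, Lemma 13] -/
def innerTab (c : ℕ × ℕ × ℕ) (q D₁ : ℕ) (pd : List Bool × List Bool × Bool) (ws : List (List ℕ)) : List (List ℕ) :=
  (List.range q).map fun a => innerRow c q D₁ pd ws a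

/-- **The next-element predictor program**: Sudan list recovery (degree `≤ dm`, agreement `≥ A₁`,
frontier cap `cap₁`) of the Hadamard-list table. [cite: Umans2003, Lemma 13 (the predictor `g`)] -/
def predL (c : ℕ × ℕ × ℕ) (q I₁ J₁ dm A₁ cap₁ D₁ : ℕ) (pd : List Bool × List Bool × Bool) (ws : List (List ℕ)) : List (List ℕ) :=
  survL c q I₁ J₁ dm A₁ cap₁ (innerTab c q D₁ pd ws) [] []

/-- The type of the predictor's data `(pd, (c, 1^q, 1^{I₁}, 1^{J₁}), (1^{dm}, A₁, 1^{cap₁}, 1^{D₁}))`. [folklore] -/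
abbrev GDat : Type := (List Bool × List Bool × Bool) × ((ℕ × ℕ × ℕ) × ℕ × ℕ × ℕ) × (ℕ × ℕ × ℕ × ℕ)

/-- Its code. [folklore] -/
abbrev gdE : GDat → List Bool :=
  pairE pdE (pairE (pairE kctxE (pairE unE (pairE unE unE))) (pairE unE (pairE natE (pairE unE unE))))

/-- The predictor program as a function of its data. [folklore] -/
def predLT (gd : GDat) (ws : List (List ℕ)) : List (List ℕ) :=
  predL gd.2.1.1 gd.2.1.2.1 gd.2.1.2.2.1 gd.2.1.2.2.2 gd.2.2.1 gd.2.2.2.1 gd.2.2.2.2.1 gd.2.2.2.2.2 gd.1 ws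

section Machine

/-- The code of coefficient lists. -/
local notation "L" => rawE natE

/-- The code of tables. -/
local notation "matE" => rawE (rawE natE)

/-- The code of `(c, pd, ws)`. -/
local notation "rcE" => pairE kctxE (pairE pdE (rawE (rawE natE)))

/-- `b = W - 1` in unary, from the context. [folklore] -/
theorem bOfC : CodeFP kctxE unE (fun c => c.1 - 1) :=
  (unOfNatMin.comp ((fst _ _).pair (natSub.comp ((natOfUn.comp (fst _ _)).pair (const _ 1))))).congr fun c => by
    simp only [id]; exact min_eq_left (Nat.sub_le _ _)

/-- **One received bit on codes**: `((c, pd, ws), (a, y)) ↦ recvBit c pd ws a y`. [folklore] -/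
theorem recvBitC : CodeFP (pairE rcE (pairE natE natE)) bitE (fun t => recvBit t.1.1 t.1.2.1 t.1.2.2 t.2.1 t.2.2) := by
  -- the prefix bits: item `u`, context `(c, a, y)`
  have hbit : CodeFP (pairE (pairE kctxE (pairE natE natE)) L) bitE (fun t => hadB (t.1.1.1 - 1) (keval t.1.1 t.2 t.1.2.1) t.1.2.2) :=
    (hadBC.comp ((bOfC.comp (fst _ _).fst').pair ((kevalC.comp ((fst _ _).fst'.pair ((snd _ _).pair (fst _ _).snd'.fst'))).pair
      (fst _ _).snd'.snd')) :)
  have hpre : CodeFP (pairE rcE (pairE natE natE)) (rawE bitE) (fun t => t.1.2.2.map fun u => hadB (t.1.1.1 - 1) (keval t.1.1 u t.2.1) t.2.2) :=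
    ((map hbit).comp ((((fst _ _).fst').pair (snd _ _)).pair (fst _ _).snd'.snd') :)
  exact ((predPC.comp ((fst _ _).snd'.fst'.pair hpre)).congr fun _ => rfl)

/-- The code of `((c, pd, ws), (1^q, 1^{D₁}))`. -/
local notation "irE" => pairE (pairE kctxE (pairE pdE (rawE (rawE natE)))) (pairE unE unE)

/-- The agreement count of the Hadamard codeword of `v` with the received block `a`:
`(((c, pd, ws), (q, D₁)), (a, v)) ↦ #{y < q | r(a, y) = had(v, y)}`. [folklore] -/
theorem hadAgreeC : CodeFP (pairE irE (pairE natE natE)) natE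
    (fun s => ((List.range s.1.2.1).filter fun y => recvBit s.1.1.1 s.1.1.2.1 s.1.1.2.2 s.2.1 y == hadB (s.1.1.1.1 - 1) s.2.2 y).length) := by
  let σE : ((((ℕ × ℕ × ℕ) × (List Bool × List Bool × Bool) × List (List ℕ)) × ℕ × ℕ) × ℕ × ℕ) × ℕ → List Bool :=
    pairE (pairE irE (pairE natE natE)) natE
  have hrc : CodeFP σE rcE (fun t => t.1.1.1) := (fst _ _).fst'.fst'
  have ha : CodeFP σE natE (fun t => t.1.2.1) := (fst _ _).snd'.fst'
  have hv : CodeFP σE natE (fun t => t.1.2.2) := (fst _ _).snd'.snd'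
  have hy : CodeFP σE natE (fun t => t.2) := snd _ _
  have hr : CodeFP σE bitE (fun t => recvBit t.1.1.1.1 t.1.1.1.2.1 t.1.1.1.2.2 t.1.2.1 t.2) := (recvBitC.comp (hrc.pair (ha.pair hy)) :)
  have hh : CodeFP σE bitE (fun t => hadB (t.1.1.1.1.1 - 1) t.1.2.2 t.2) := (hadBC.comp ((bOfC.comp hrc.fst').pair (hv.pair hy)) :)
  have hp : CodeFP σE bitE (fun t => recvBit t.1.1.1.1 t.1.1.1.2.1 t.1.1.1.2.2 t.1.2.1 t.2 == hadB (t.1.1.1.1.1 - 1) t.1.2.2 t.2) :=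
    ((beq bitE_injective).comp (hr.pair hh) :)
  exact (((natLength natE).comp ((filter hp).comp ((CodeFP.id _).pair (urange.comp (fst _ _).snd'.fst')))).congr fun _ => rfl)

/-- **One Hadamard list on codes**: `(((c, pd, ws), (q, D₁)), a) ↦ innerRow c q D₁ pd ws a`. [folklore] -/
theorem innerRowC : CodeFP (pairE irE natE) L (fun t => innerRow t.1.1.1 t.1.2.1 t.1.2.2 t.1.1.2.1 t.1.1.2.2 t.2) := by
  -- item `v`, context `(t, a)`
  let σE : ((((ℕ × ℕ × ℕ) × (List Bool × List Bool × Bool) × List (List ℕ)) × ℕ × ℕ) × ℕ) × ℕ → List Bool := pairE (pairE irE natE) natE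
  have hcnt : CodeFP σE natE (fun s => ((List.range s.1.1.2.1).filter fun y =>
      recvBit s.1.1.1.1 s.1.1.1.2.1 s.1.1.1.2.2 s.1.2 y == hadB (s.1.1.1.1.1 - 1) s.2 y).length) :=
    (hadAgreeC.comp ((fst _ _).fst'.pair ((fst _ _).snd'.pair (snd _ _))) :)
  have hq : CodeFP σE natE (fun s => s.1.1.2.1) := natOfUn.comp (fst _ _).fst'.snd'.fst'
  have hD : CodeFP σE natE (fun s => s.1.1.2.2) := natOfUn.comp (fst _ _).fst'.snd'.snd'
  have hp : CodeFP σE bitE (fun s => decide (s.1.1.2.1 + s.1.1.2.2 ≤ 2 * ((List.range s.1.1.2.1).filter fun y =>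
      recvBit s.1.1.1.1 s.1.1.1.2.1 s.1.1.1.2.2 s.1.2 y == hadB (s.1.1.1.1.1 - 1) s.2 y).length)) :=
    (natLe.comp ((natAdd.comp (hq.pair hD)).pair (natMul.comp ((const _ 2).pair hcnt))) :)
  exact (((filter hp).comp ((CodeFP.id _).pair (urange.comp (fst _ _).snd'.fst'))).congr fun _ => rfl)

/-- **The Hadamard-list table on codes**: `((c, pd, ws), (q, D₁)) ↦ innerTab c q D₁ pd ws`. [folklore] -/
theorem innerTabC : CodeFP irE matE (fun t => innerTab t.1.1 t.2.1 t.2.2 t.1.2.1 t.1.2.2) :=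
  ((map innerRowC).comp ((CodeFP.id _).pair (urange.comp (snd _ _).fst'))).congr fun _ => rfl

/-- **The predictor program on codes**: `(gd, ws) ↦ predLT gd ws`. [cite: Umans2003, Lemma 13; AroraBarak2009, §1.3] -/
theorem predLTC : CodeFP (pairE gdE matE) matE (fun t => predLT t.1 t.2) := by
  have hpd : CodeFP (pairE gdE matE) pdE (fun t => t.1.1) := (fst _ _).fst'
  have hc : CodeFP (pairE gdE matE) kctxE (fun t => t.1.2.1.1) := (fst _ _).snd'.fst'.fst'
  have hq : CodeFP (pairE gdE matE) unE (fun t => t.1.2.1.2.1) := (fst _ _).snd'.fst'.snd'.fst'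
  have hI : CodeFP (pairE gdE matE) unE (fun t => t.1.2.1.2.2.1) := (fst _ _).snd'.fst'.snd'.snd'.fst'
  have hJ : CodeFP (pairE gdE matE) unE (fun t => t.1.2.1.2.2.2) := (fst _ _).snd'.fst'.snd'.snd'.snd'
  have hdm : CodeFP (pairE gdE matE) unE (fun t => t.1.2.2.1) := (fst _ _).snd'.snd'.fst'
  have hA : CodeFP (pairE gdE matE) natE (fun t => t.1.2.2.2.1) := (fst _ _).snd'.snd'.snd'.fst'
  have hcap : CodeFP (pairE gdE matE) unE (fun t => t.1.2.2.2.2.1) := (fst _ _).snd'.snd'.snd'.snd'.fst'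
  have hD : CodeFP (pairE gdE matE) unE (fun t => t.1.2.2.2.2.2) := (fst _ _).snd'.snd'.snd'.snd'.snd'
  have hws : CodeFP (pairE gdE matE) matE (fun t => t.2) := snd _ _
  have htab : CodeFP (pairE gdE matE) matE (fun t => innerTab t.1.2.1.1 t.1.2.1.2.1 t.1.2.2.2.2.2 t.1.1 t.2) :=
    (innerTabC.comp ((hc.pair (hpd.pair hws)).pair (hq.pair hD)) :)
  have htuple : CodeFP (pairE gdE matE) decE (fun t => ((t.1.2.1.1, t.1.2.1.2.1, t.1.2.1.2.2.1, t.1.2.1.2.2.2), (t.1.2.2.1, t.1.2.2.2.1, t.1.2.2.2.2.1),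
      (innerTab t.1.2.1.1 t.1.2.1.2.1 t.1.2.2.2.2.2 t.1.1 t.2, ([] : List ℕ), ([] : List ℕ)))) :=
    (hc.pair (hq.pair (hI.pair hJ))).pair ((hdm.pair (hA.pair hcap)).pair (htab.pair ((const _ ([] : List ℕ)).pair (const _ ([] : List ℕ)))))
  exact ((survLC.comp htuple).congr fun _ => rfl)

end Machine

end UmansFP

end Literature.Computability.Complexity

end
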